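import Summits.CriticalPhenomena.CardyFormulaZ2.Theorems.CardyMagicRigidityNestingRigidityTPinchWitness
import Literature.Probability.Percolation.AltFourArmLowerBound
import Literature.Probability.Percolation.SiteReimer
import Literature.Probability.Percolation.TriThetaHalf
import HarnessLib

/-!
# (I0) `TPinchPositive`: the selection event of stub S11 has probability bounded below at ratio `2`

Crux `Summit.CriticalPhenomena.CardyFormulaZ2.Theses.CardyMagicRigidity.NestingRigidity` (stmt-CriticalPhenomena-4835),
line `pinch-resampling` v4, stub S11 `stub_neckHookupCoarseT`.  **`tPinchPositive_holds : TPinchPositive`** — there are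
`s₀` and `c₀ > 0` with `P_{1/2}(TPinch x x s s) ≥ c₀` for all centres `x` and all `s ≥ s₀` (exactly two open and exactly
two closed crossing clusters of the collar `Λ_{2s}(x) ∖ Λ_s(x)` of critical site percolation on `𝕋`).

Proof ("an extra crossing cluster costs a disjoint crossing"):
* `twoCrossingClusters_map`, `tPinch_eq_preimage_zero` — the cluster-form predicates are transported by lattice
  automorphisms, so `P(TPinch x x s s) = P(TPinch 0 0 s s)` (`sitePercolation_real_preimage_relabel`);
* `tPinch_zero_of_not_mem_disjointOccurrence` (`…TPinchWitness`) — `T ∖ (T □ C) ⊆ TPinch 0 0 s s` for the tree events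
  `T = TFourArmTwoClusters 0 (s+1) (2s)` (two open crossing clusters) and `C = armEvent ![false] (s+1) (2s)` (a closed
  crossing), whence `P(TPinch 0 0 s s) ≥ P(T) - P(T □ C) ≥ P(T) (1 - P(C))` by REIMER's inequality for site percolation
  (`sitePercolation_reimer`);
* `P(T) ≥ c/4` from the tree's alternating four-arm lower bound `altFourArm_lowerBound` at `t = 1/2`
  (`altFourArm ⊆ T`), and `1 - P(C) ≥ c₇⁶` from the six RSW crossings of the pieces of the
  hexagonal annulus `5k ≤ |·| ≤ 7k`, `k = ⌊(2s-1)/7⌋` (`pow_six_le_real_iInter_isoTBCrossing`, `tri_rsw_half_holds`),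
  which exclude closed crossings (`not_mem_armEvent_of_six_crossings`).

No named fact is introduced; the RSW inputs are the tree's proved `tri_rsw_half_holds` and `altFourArm_lowerBound`.
-/

noncomputable section

namespace Summit.CriticalPhenomena.CardyFormulaZ2.Cruxes.NestingRigidity.PinchResampling

open MeasureTheory Set Literature.Probability.Percolation Literature.Probability.LatticeModels
open scoped Literature.Probability.Percolation

/-! ### Transport of the cluster-form predicates along a bijection of the vertices -/

namespace TPinchPos

section Transport

variable {V W : Type*} {G H : SimpleGraph V} {G' H' : SimpleGraph W} (e : V ≃ W)

/-- Paths inside a set are transported along a bijection compatible with the adjacency relations (a graph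
isomorphism). -/
theorem pathIn_map_equiv (hH : ∀ a b, H'.Adj (e a) (e b) ↔ H.Adj a b) {A : Set V} {u v : V} :
    PathIn H' (e '' A) (e u) (e v) ↔ PathIn H A u v := by
  constructor
  · intro h
    have := pathIn_map_iso ({ toEquiv := e, map_rel_iff' := hH _ _ } : H ≃g H').symm h
    simpa [Equiv.symm_image_image] using this
  · intro h
    exact pathIn_map_iso ({ toEquiv := e, map_rel_iff' := hH _ _ } : H ≃g H') h

/-- The inner layer is transported along a compatible bijection. -/
theorem mem_innerLayer_map (hG : ∀ a b, G'.Adj (e a) (e b) ↔ G.Adj a b) {I O : Set V} {v : V} :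
    e v ∈ innerLayer G' (e '' I) (e '' O) ↔ v ∈ innerLayer G I O := by
  simp only [innerLayer, mem_setOf_eq, Set.mem_sdiff, e.injective.mem_set_image]
  constructor
  · rintro ⟨hv, w, ⟨w', hw', rfl⟩, hadj⟩
    exact ⟨hv, w', hw', (hG _ _).1 hadj⟩
  · rintro ⟨hv, w, hw, hadj⟩
    exact ⟨hv, e w, mem_image_of_mem _ hw, (hG _ _).2 hadj⟩

/-- The outer layer is transported along a compatible bijection. -/
theorem mem_outerLayer_map (hG : ∀ a b, G'.Adj (e a) (e b) ↔ G.Adj a b) {I O : Set V} {v : V} :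
    e v ∈ outerLayer G' (e '' I) (e '' O) ↔ v ∈ outerLayer G I O := by
  simp only [outerLayer, mem_setOf_eq, Set.mem_sdiff, e.injective.mem_set_image]
  constructor
  · rintro ⟨hv, w, hw, hadj⟩
    obtain ⟨w', rfl⟩ := e.surjective w
    exact ⟨hv, w', fun h ↦ hw (mem_image_of_mem _ h), (hG _ _).1 hadj⟩
  · rintro ⟨hv, w, hw, hadj⟩
    exact ⟨hv, e w, fun h ↦ hw ((e.injective.mem_set_image).1 h), (hG _ _).2 hadj⟩

/-- Crossings in cluster form are transported along a compatible bijection. -/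
theorem isCrossing_map (hG : ∀ a b, G'.Adj (e a) (e b) ↔ G.Adj a b) (hH : ∀ a b, H'.Adj (e a) (e b) ↔ H.Adj a b)
    {I O : Set V} {v : V} : IsCrossing G' H' (e '' I) (e '' O) (e v) ↔ IsCrossing G H I O v := by
  simp only [IsCrossing, mem_innerLayer_map e hG, ← image_sdiff e.injective]
  constructor
  · rintro ⟨hv, w, hw, hp⟩
    obtain ⟨w', rfl⟩ := e.surjective w
    exact ⟨hv, w', (mem_outerLayer_map e hG).1 hw, (pathIn_map_equiv e hH).1 hp⟩
  · rintro ⟨hv, w, hw, hp⟩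
    exact ⟨hv, e w, (mem_outerLayer_map e hG).2 hw, (pathIn_map_equiv e hH).2 hp⟩

/-- **`TwoCrossingClusters` is transported along a compatible bijection of the vertices.** -/
theorem twoCrossingClusters_map (hG : ∀ a b, G'.Adj (e a) (e b) ↔ G.Adj a b)
    (hH : ∀ a b, H'.Adj (e a) (e b) ↔ H.Adj a b) {I O : Set V} :
    TwoCrossingClusters G' H' (e '' I) (e '' O) ↔ TwoCrossingClusters G H I O := by
  have hc : ∀ v, IsCrossing G' H' (e '' I) (e '' O) (e v) ↔ IsCrossing G H I O v := fun v ↦ isCrossing_map e hG hH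
  have hp : ∀ u v, PathIn H' (e '' O \ e '' I) (e u) (e v) ↔ PathIn H (O \ I) u v := fun u v ↦ by
    rw [← image_sdiff e.injective]; exact pathIn_map_equiv e hH
  constructor
  · rintro ⟨⟨v₁, v₂, h₁, h₂, h₃⟩, hall⟩
    obtain ⟨v₁, rfl⟩ := e.surjective v₁
    obtain ⟨v₂, rfl⟩ := e.surjective v₂
    refine ⟨⟨v₁, v₂, (hc _).1 h₁, (hc _).1 h₂, fun h ↦ h₃ ((hp _ _).2 h)⟩, fun u₁ u₂ u₃ k₁ k₂ k₃ ↦ ?_⟩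
    rcases hall (e u₁) (e u₂) (e u₃) ((hc _).2 k₁) ((hc _).2 k₂) ((hc _).2 k₃) with h | h | h
    · exact Or.inl ((hp _ _).1 h)
    · exact Or.inr (Or.inl ((hp _ _).1 h))
    · exact Or.inr (Or.inr ((hp _ _).1 h))
  · rintro ⟨⟨v₁, v₂, h₁, h₂, h₃⟩, hall⟩
    refine ⟨⟨e v₁, e v₂, (hc _).2 h₁, (hc _).2 h₂, fun h ↦ h₃ ((hp _ _).1 h)⟩, fun u₁ u₂ u₃ k₁ k₂ k₃ ↦ ?_⟩
    obtain ⟨u₁, rfl⟩ := e.surjective u₁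
    obtain ⟨u₂, rfl⟩ := e.surjective u₂
    obtain ⟨u₃, rfl⟩ := e.surjective u₃
    rcases hall u₁ u₂ u₃ ((hc _).1 k₁) ((hc _).1 k₂) ((hc _).1 k₃) with h | h | h
    · exact Or.inl ((hp _ _).2 h)
    · exact Or.inr (Or.inl ((hp _ _).2 h))
    · exact Or.inr (Or.inr ((hp _ _).2 h))

end Transport

/-! ### Translation of the selection event to the origin -/

/-- The translation `v ↦ v - x` maps `Λ_r(x)` onto `Λ_r(0)`. -/
theorem image_shift_tBall (x : Site 2) (r : ℕ) : (triShiftIso (-x)).toEquiv '' tBall x r = tBall 0 r := by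
  ext v
  constructor
  · rintro ⟨a, ha, rfl⟩
    simpa [tBall, sub_eq_add_neg] using ha
  · intro hv
    refine ⟨v + x, ?_, by simp⟩
    simpa [tBall] using hv

/-- The colour graphs of `ω` and of its translate correspond under the translation. -/
theorem tColourGraph_adj_shift (x : Site 2) (ω : SiteConfig (Site 2)) (c : Bool) (a b : Site 2) :
    (tColourGraph (SiteConfig.relabel (triShiftIso (-x)).toEquiv ω) c).Adj ((triShiftIso (-x)).toEquiv a)
        ((triShiftIso (-x)).toEquiv b) ↔ (tColourGraph ω c).Adj a b := by
  simp only [tColourGraph, siteOpenGraph_adj, mem_setOf_eq]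
  rw [show ((triShiftIso (-x)).toEquiv a : Site 2) = a + -x from rfl,
    show ((triShiftIso (-x)).toEquiv b : Site 2) = b + -x from rfl,
    mem_relabel_triShiftIso_neg_iff, mem_relabel_triShiftIso_neg_iff, neg_add_cancel_right, neg_add_cancel_right]
  have hadj : triGraph.Adj (a + -x) (b + -x) ↔ triGraph.Adj a b := triGraph_adj_shift_iff (-x) a b
  rw [hadj]

/-- **Translation to the origin**: `TPinch x x s s` is the preimage of `TPinch 0 0 s s` under the relabelling of the
configuration by `v ↦ v - x`. -/
theorem tPinch_eq_preimage_zero (x : Site 2) (s : ℕ) :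
    TPinch x x s s = SiteConfig.relabel (triShiftIso (-x)).toEquiv ⁻¹' TPinch 0 0 s s := by
  ext ω
  simp only [TPinch, TFourArms, mem_preimage, mem_setOf_eq]
  have hG : ∀ a b : Site 2, triGraph.Adj ((triShiftIso (-x)).toEquiv a) ((triShiftIso (-x)).toEquiv b) ↔
      triGraph.Adj a b := fun a b ↦ triGraph_adj_shift_iff (-x) a b
  rw [← image_shift_tBall x s, ← image_shift_tBall x (2 * s),
    twoCrossingClusters_map _ hG (tColourGraph_adj_shift x ω true),
    twoCrossingClusters_map _ hG (tColourGraph_adj_shift x ω false)]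

/-- **Translation invariance of the selection probability.** -/
theorem real_tPinch_eq_zero (x : Site 2) (s : ℕ) :
    (triSitePercolation half).real (TPinch x x s s) = (triSitePercolation half).real (TPinch 0 0 s s) := by
  rw [tPinch_eq_preimage_zero x s]
  exact sitePercolation_real_preimage_relabel _ _ _

/-! ### The two probabilistic inputs at the origin -/

/-- **The tree's alternating four-arm event has two open crossing clusters**: `altFourArm n N ⊆ TFourArmTwoClusters 0 n N`
(`n ≤ N`). -/
theorem altFourArm_subset_tFourArmTwoClusters {n N : ℕ} (hnN : n ≤ N) : altFourArm n N ⊆ TFourArmTwoClusters 0 n N := by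
  rintro ω ⟨x, y, w, hw, -, hsep, -⟩
  have path : ∀ j, ![true, false, true, false] j = true → PathIn triGraph (triAnn n N ∩ ω) (x j) (y j) := by
    intro j hj
    obtain ⟨-, -, -, hsupp, hcol⟩ := hw j
    refine PathIn.of_walk (w j) fun z hz ↦ ⟨?_, ?_⟩
    · rcases hsupp z hz with h | h
      · rw [Set.mem_sdiff, Finset.mem_coe, Finset.mem_coe, mem_triBall_iff, mem_triBall_iff, not_le] at h
        exact mem_triAnn.2 ⟨by omega, h.1⟩
      · rw [mem_triSphere_iff] at h
        exact mem_triAnn.2 ⟨h.ge, by rw [h]; exact_mod_cast hnN⟩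
    · have := (hcol z hz).2
      rw [hj] at this
      exact this rfl
  exact TPinchPos.mem_tFourArmTwoClusters_zero_of (mem_triSphere_iff.1 (hw 0).1) (mem_triSphere_iff.1 (hw 0).2.1)
    (mem_triSphere_iff.1 (hw 2).1) (mem_triSphere_iff.1 (hw 2).2.1) (path 0 rfl) (path 2 rfl)
    (hsep _ (w 0).start_mem_support _ (w 2).start_mem_support)

/-- **RSW lower bound for two open crossing clusters at ratio `2`**: there are `s₁` and `c₁ > 0` with
`P_{1/2}(TFourArmTwoClusters 0 (s+1) (2s)) ≥ c₁` for `s ≥ s₁` (the tree's `altFourArm_lowerBound` at `t = 1/2`, radii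
`s + 1 ≤ 2s`). -/
theorem exists_le_real_tFourArmTwoClusters :
    ∃ s₁ : ℕ, ∃ c₁ : ℝ, 0 < c₁ ∧ ∀ s : ℕ, s₁ ≤ s →
      c₁ ≤ (triSitePercolation half).real (TFourArmTwoClusters 0 (s + 1) (2 * s)) := by
  obtain ⟨ε₁, hε₁, H⟩ := altFourArm_lowerBound
  obtain ⟨r₁, δ, hδ, β, hβ, c, hc, H'⟩ := H (ε := ε₁ / 2) (by linarith) (by linarith)
  refine ⟨max r₁ 1, c / 4, by positivity, fun s hs ↦ ?_⟩
  have hs1 : 1 ≤ s := le_of_max_le_right hs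
  have hr : r₁ ≤ s + 1 := by have := le_of_max_le_left hs; omega
  have key := H' half (by rw [coe_half]) (by rw [coe_half]; linarith) (s + 1) (2 * s) hr (by omega)
    (fun h ↦ absurd h (by rw [coe_half]; exact lt_irrefl _))
  have hx0 : (0 : ℝ) < ((s + 1 : ℕ) : ℝ) / ((2 * s : ℕ) : ℝ) := by positivity
  have hx1 : ((s + 1 : ℕ) : ℝ) / ((2 * s : ℕ) : ℝ) ≤ 1 := by
    rw [div_le_one (by positivity)]; exact_mod_cast (by omega : s + 1 ≤ 2 * s)
  have hxhalf : (1 : ℝ) / 2 ≤ ((s + 1 : ℕ) : ℝ) / ((2 * s : ℕ) : ℝ) := by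
    rw [div_le_div_iff₀ (by norm_num) (by positivity)]; push_cast; linarith
  have hpow : (1 : ℝ) / 4 ≤ (((s + 1 : ℕ) : ℝ) / ((2 * s : ℕ) : ℝ)) ^ (2 - β) :=
    calc (1 : ℝ) / 4 = (1 / 2) ^ (2 : ℝ) := by norm_num
      _ ≤ (((s + 1 : ℕ) : ℝ) / ((2 * s : ℕ) : ℝ)) ^ (2 : ℝ) := Real.rpow_le_rpow (by norm_num) hxhalf (by norm_num)
      _ ≤ (((s + 1 : ℕ) : ℝ) / ((2 * s : ℕ) : ℝ)) ^ (2 - β) := Real.rpow_le_rpow_of_exponent_ge hx0 hx1 (by linarith)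
  calc c / 4 = c * (1 / 4) := by ring
    _ ≤ c * (((s + 1 : ℕ) : ℝ) / ((2 * s : ℕ) : ℝ)) ^ (2 - β) := mul_le_mul_of_nonneg_left hpow hc.le
    _ ≤ altFourArmProbAt half (s + 1) (2 * s) := key
    _ ≤ (triSitePercolation half).real (TFourArmTwoClusters 0 (s + 1) (2 * s)) :=
        measureReal_mono (altFourArm_subset_tFourArmTwoClusters (by omega)) (measure_ne_top _ _)

/-- `TFourArmTwoClusters 0 n N` reads only the sites of `triAnnulus n N`. -/
theorem determinedBy_tFourArmTwoClusters_zero (n N : ℕ) :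
    DeterminedBy (TFourArmTwoClusters 0 n N) ↑(triAnnulus n N) := by
  have h := determinedBy_tFourArmTwoClusters 0 n N
  rwa [tAnnulus_zero_eq_triAnn] at h

/-- **RSW upper bound for a closed crossing at ratio `2`**: there is `c₂ > 0` with
`P_{1/2}(armEvent ![false] (s+1) (2s)) ≤ 1 - c₂` for `s ≥ 15` (six long-way open crossings of the pieces of
`5k ≤ |·| ≤ 7k`, `k = ⌊(2s-1)/7⌋`, Harris–FKG and RSW at aspect ratio `7`). -/
theorem exists_real_armEvent_false_le :
    ∃ c₂ : ℝ, 0 < c₂ ∧ ∀ s : ℕ, 15 ≤ s → (triSitePercolation half).real (armEvent ![false] (s + 1) (2 * s)) ≤ 1 - c₂ := by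
  obtain ⟨c, hc, hcross⟩ := tri_rsw_half_holds 7 (by norm_num)
  refine ⟨c ^ 6, by positivity, fun s hs ↦ ?_⟩
  set k : ℕ := (2 * s - 1) / 7 with hk
  have hdm := Nat.div_add_mod (2 * s - 1) 7
  have hml := Nat.mod_lt (2 * s - 1) (by norm_num : 7 > 0)
  have hk1 : 1 ≤ k := by omega
  have hnk : ((s + 1 : ℕ) : ℤ) < 5 * k := by push_cast; omega
  have hkN : 7 * (k : ℤ) < ((2 * s : ℕ) : ℤ) := by push_cast; omega
  have hfloor : ⌊(7 : ℝ) * k⌋₊ = 7 * k := by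
    rw [show (7 : ℝ) * k = ((7 * k : ℕ) : ℝ) by push_cast; ring, Nat.floor_natCast]
  have hP : c ≤ triLRCrossingProb half (7 * k) k := by
    have := (hcross k (by rw [hfloor]; omega)).1
    rwa [hfloor] at this
  have hsub : (⋂ j < 6, isoTBCrossing (pieceIso k j) k (7 * k)) ⊆ (armEvent ![false] (s + 1) (2 * s))ᶜ := by
    intro ω hω
    simp only [mem_iInter] at hω
    exact not_mem_armEvent_of_six_crossings hk1 hnk hkN hω
  have h1 : c ^ 6 ≤ (triSitePercolation half).real (armEvent ![false] (s + 1) (2 * s))ᶜ :=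
    calc c ^ 6 ≤ triLRCrossingProb half (7 * k) k ^ 6 := by gcongr
      _ ≤ (triSitePercolation half).real (⋂ j < 6, isoTBCrossing (pieceIso k j) k (7 * k)) :=
          pow_six_le_real_iInter_isoTBCrossing k
      _ ≤ (triSitePercolation half).real (armEvent ![false] (s + 1) (2 * s))ᶜ := measureReal_mono hsub (measure_ne_top _ _)
  rw [probReal_compl_eq_one_sub (measurableSet_armEvent _ (by omega))] at h1
  linarith

/-! ### Assembly -/

/-- **(I0) at the origin**: `P_{1/2}(TPinch 0 0 s s) ≥ c₀ > 0` for `s ≥ s₀` — Reimer's inequality turns the extra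
closed crossing cluster into a DISJOINT closed crossing, which costs the factor `P(armEvent ![false]) ≤ 1 - c₂`. -/
theorem exists_le_real_tPinch_zero :
    ∃ s₀ : ℕ, ∃ c₀ : ℝ, 0 < c₀ ∧ ∀ s : ℕ, s₀ ≤ s → c₀ ≤ (triSitePercolation half).real (TPinch 0 0 s s) := by
  obtain ⟨s₁, c₁, hc₁, hT⟩ := exists_le_real_tFourArmTwoClusters
  obtain ⟨c₂, hc₂, hC⟩ := exists_real_armEvent_false_le
  refine ⟨max s₁ 15, c₁ * c₂, mul_pos hc₁ hc₂, fun s hs ↦ ?_⟩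
  have hs₁ : s₁ ≤ s := le_of_max_le_left hs
  have hs15 : 15 ≤ s := le_of_max_le_right hs
  set T := TFourArmTwoClusters 0 (s + 1) (2 * s) with hTdef
  set C := armEvent ![false] (s + 1) (2 * s) with hCdef
  set μ := triSitePercolation half with hμ
  -- Reimer
  have hreimer : μ.real (T □ C) ≤ μ.real T * μ.real C :=
    sitePercolation_reimer half (F := triAnnulus (s + 1) (2 * s)) (determinedBy_tFourArmTwoClusters_zero _ _)
      (determinedBy_armEvent _ (by omega))
  -- the deterministic inclusion
  have hincl : T \ (T □ C) ⊆ TPinch 0 0 s s := fun ω hω ↦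
    tPinch_zero_of_not_mem_disjointOccurrence (by omega) hω.1 hω.2
  have hsplit : μ.real T ≤ μ.real (T \ (T □ C)) + μ.real (T □ C) :=
    calc μ.real T ≤ μ.real (T \ (T □ C) ∪ (T □ C)) := measureReal_mono (by rw [Set.sdiff_union_self]; exact subset_union_left)
          (measure_ne_top _ _)
      _ ≤ μ.real (T \ (T □ C)) + μ.real (T □ C) := measureReal_union_le _ _
  have hTs := hT s hs₁
  have hCs := hC s hs15
  have hT0 : 0 ≤ μ.real T := measureReal_nonneg
  calc c₁ * c₂ ≤ μ.real T * (1 - μ.real C) := mul_le_mul hTs (by linarith) hc₂.le hT0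
    _ = μ.real T - μ.real T * μ.real C := by ring
    _ ≤ μ.real T - μ.real (T □ C) := by linarith
    _ ≤ μ.real (T \ (T □ C)) := by linarith
    _ ≤ μ.real (TPinch 0 0 s s) := measureReal_mono hincl (measure_ne_top _ _)

end TPinchPos

/-- **(I0) `TPinchPositive` holds**: there are `s₀` and `c₀ > 0` such that for every centre `x` and every `s ≥ s₀`, with
`P_{1/2}`-probability at least `c₀` the collar `Λ_{2s}(x) ∖ Λ_s(x)` of critical site percolation on `𝕋` has exactly two
open and exactly two closed crossing clusters. -/
theorem tPinchPositive_holds : TPinchPositive := by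
  obtain ⟨s₀, c₀, hc₀, h⟩ := TPinchPos.exists_le_real_tPinch_zero
  exact ⟨s₀, c₀, hc₀, fun x s hs ↦ by rw [TPinchPos.real_tPinch_eq_zero]; exact h s hs⟩

end Summit.CriticalPhenomena.CardyFormulaZ2.Cruxes.NestingRigidity.PinchResampling

end
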